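import Literature.Barriers.HodgeConjecture.IntegralCoefficientsCurvePurity
import Literature.AlgebraicTopology.SingularHomology.LocallyFlatComplement
import Literature.AlgebraicTopology.SingularHomology.LocalHomologyVanishing
import Literature.NumberTheory.Transcendental.AnalytificationSecondCountableProofs
import HarnessLib

/-!
# Kollár (1992): semipurity `Hq(U, U ∖ S; ℤ) = 0`, `q < 4`, for the straightened smooth part of a
# curve on a threefold — the topological input of `…CurvePurity` below the Thom degree, PROVED

Sibling of `Literature/Barriers/HodgeConjecture/IntegralCoefficientsCurvePurity`, which reduces the
purity half of hypothesis (i') of the Kollár reduction (one irreducible curve `C` on the smooth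
projective threefold `X`) to the cyclicity of ONE group: `H⁴(U, U ∖ S; ℤ)`, `U = (X ∖ Z₁)(ℂ)`,
`U ∖ S = (X ∖ C)(ℂ)`, for a finite `Z₁ ⊆ C` off which `C(ℂ)` is straightened by charts
`X(ℂ) ⇀ ℂ² × K` (`ker_restrictComplInt_le_span_of_flat_cyclic`). This file proves that in that
situation the relative HOMOLOGY vanishes below the Thom degree,
`Hq(U, U ∖ S; M) = 0` for `q < 4` (`isZero_relativeSingularHomology_of_straightened`), by feeding the
straightening charts, restricted to the open subspace `U`, to the tree's engine
`Literature.AlgebraicTopology.SingularHomology.surjective_injective_map_compl_of_locallyFlat`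
(Voisin I, §11.1.2 Lemma 11.13 in topological form: `Hq(U ∖ S) → Hq(U)` onto for `q < 4`, one-to-one
for `q + 1 < 4`; the pattern of `HodgeTheory.surjective_map_complexPointsCompl_of_le_coheight`) and
reading the long exact sequence of the pair (`isZero_relativeSingularHomology_succ_of_surjective_of_injective`).
So of the topology of "`H⁴_C(X; ℤ) = ℤ · cl(C)`" exactly the degree-`4` step remains
(the Thom class of the connected, locally flat, codimension-`4` closed subset `S` of `U`;
`H₃(U, U ∖ S; ℤ) = 0` proved here is also the hypothesis under which the tree's relative Kronecker
duality `RelativeCochainsKronecker` identifies `H⁴(U, U ∖ S; ℤ)` with `Hom(H₄(U, U ∖ S; ℤ), ℤ)`).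

Everything is proved; no named facts.

## References

* [VoisinHodgeI2002] C. Voisin, Hodge Theory and Complex Algebraic Geometry I, §11.1.2 Lemma 11.13.
* [HatcherAT2002] A. Hatcher, Algebraic Topology, CUP 2002, §2.1 Thm. 2.13 ff. (pairs), §3.3.
* [SerreGAGA1956] J.-P. Serre, GAGA, Ann. Inst. Fourier 6 (1956), §2 n°5, §6 Prop. 3 Cor. 3.
* [SouleVoisin2005] C. Soulé, C. Voisin, Adv. Math. 198 (2005), §2 Thm. 2.
-/

noncomputable section

open CategoryTheory Limits AlgebraicGeometry Set Topology TopologicalSpace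
open Literature.AlgebraicTopology.SingularHomology Literature.AlgebraicGeometry.Motives

namespace Literature.Barriers.HodgeConjecture

section Barriers
section HodgeConjecture

/-! ### From the absolute maps to the relative groups (long exact sequence of the pair) -/

section Pair

universe u v

variable (R : Type v) [CommRing R] (M : Type v) [AddCommGroup M] [Module R M]
  {Y : Type u} [TopologicalSpace Y]

/-- **`Hq₊₁(A) → Hq₊₁(Y)` onto and `Hq(A) → Hq(Y)` one-to-one give `Hq₊₁(Y, A) = 0`** (the long
exact sequence of the pair, Hatcher 2002, Thm. 2.13 ff.: `Hq₊₁(A) → Hq₊₁(Y) → Hq₊₁(Y, A) →∂ Hq(A) →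
Hq(Y)`). [cite: HatcherAT2002, §2.1 Thm. 2.13 ff.] -/
theorem isZero_relativeSingularHomology_succ_of_surjective_of_injective (A : Set Y) {q : ℕ}
    (hs : Function.Surjective (singularHomology.map R M (subsetIncl A) (q + 1)))
    (hi : Function.Injective (singularHomology.map R M (subsetIncl A) q)) :
    IsZero (relativeSingularHomology R M Y A (q + 1)) := by
  refine ModuleCat.isZero_of_subsingleton_of ?_
  intro x
  -- `∂x = 0` since `Hq(A) → Hq(Y)` kills it and is one-to-one
  have h1 : relativeSingularHomology.δ R M Y A q x = 0 := by
    apply hi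
    rw [map_zero, ← ModuleCat.comp_apply, relativeSingularHomology.δ_comp_map]
    rfl
  -- so `x = j_* y`, and `y = i_* a`, whence `x = j_* i_* a = 0`
  obtain ⟨y, rfl⟩ := ((ShortComplex.moduleCat_exact_iff _).1
    (relativeSingularHomology.exact_ofAbsolute_δ R M A q)) x h1
  obtain ⟨a, rfl⟩ := hs y
  change (singularHomology.map R M (subsetIncl A) (q + 1) ≫
    relativeSingularHomology.ofAbsolute R M Y A (q + 1)) a = 0
  rw [relativeSingularHomology.map_comp_ofAbsolute]
  rfl
where
  /-- an object all of whose elements vanish is zero -/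
  ModuleCat.isZero_of_subsingleton_of {N : ModuleCat.{max u v} R} (h : ∀ x : N, x = 0) :
      IsZero N :=
    haveI : Subsingleton N := ⟨fun a b ↦ (h a).trans (h b).symm⟩
    ModuleCat.isZero_of_subsingleton N

/-- **`H₀(A) → H₀(Y)` onto gives `H₀(Y, A) = 0`** (`H₀(Y) → H₀(Y, A)` is onto, Hatcher §2.1).
[cite: HatcherAT2002, §2.1 Thm. 2.13 ff.] -/
theorem isZero_relativeSingularHomology_zero_of_surjective (A : Set Y)
    (hs : Function.Surjective (singularHomology.map R M (subsetIncl A) 0)) :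
    IsZero (relativeSingularHomology R M Y A 0) := by
  refine isZero_relativeSingularHomology_succ_of_surjective_of_injective.ModuleCat.isZero_of_subsingleton_of
    R ?_
  intro x
  haveI := relativeSingularHomology.epi_ofAbsolute_zero (R := R) (M := M) (X := Y) A
  obtain ⟨y, rfl⟩ := (ModuleCat.epi_iff_surjective
    (relativeSingularHomology.ofAbsolute R M Y A 0)).1 inferInstance x
  obtain ⟨a, rfl⟩ := hs y
  change (singularHomology.map R M (subsetIncl A) 0 ≫
    relativeSingularHomology.ofAbsolute R M Y A 0) a = 0
  rw [relativeSingularHomology.map_comp_ofAbsolute]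
  rfl

end Pair

/-! ### The straightened smooth part of a curve on a threefold -/

variable {X : SchemeOver ℂ}

/-- **Semipurity for the straightened smooth part of a curve: `Hq(U, U ∖ S; M) = 0` for `q < 4`.**
Let `X/ℂ` be a smooth projective threefold, `C ⊆ X` Zariski-closed, and `Z₁ ⊆ X` Zariski-closed such
that at every complex point `P` with `pt P ∈ C ∖ Z₁` the subset `C(ℂ)` of `X(ℂ)` is straightened by
an open partial homeomorphism `X(ℂ) ⇀ ℂ² × K` (`pt Q ∈ C ↔ (e Q).1 = 0` on `e.source`; the tree's
`GAGADimension.exists_closed_straightening_off` with `normalDim_eq_two_of_straightening`). Then for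
the open subspace `U = (X ∖ Z₁)(ℂ)` and `U ∖ S = {Q | pt Q ∉ C}`, `Hq(U, U ∖ S; M) = 0` for all
`q < 4` and all coefficients: `S` is closed and locally flat of real codimension `4` in the second
countable space `U`, so `Hq(U ∖ S) → Hq(U)` is onto for `q < 4` and one-to-one for `q + 1 < 4`
(`surjective_injective_map_compl_of_locallyFlat`, Voisin I Lemma 11.13), and the long exact
sequence of the pair concludes. This is the vanishing below the Thom degree for the pair whose
degree-`4` group `…CurvePurity` asks to be cyclic. [cite: VoisinHodgeI2002, §11.1.2 Lemma 11.13]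
[cite: HatcherAT2002, §2.1 Thm. 2.13 ff.] [cite: SerreGAGA1956, §2 n°5 and §6 Prop. 3 Cor. 3] -/
theorem isZero_relativeSingularHomology_of_straightened (R : Type) [CommRing R] (M : Type)
    [AddCommGroup M] [Module R M] (hX : IsSmoothProjective 3 X) {C Z₁ : Set X.left}
    (hC : IsClosed C) (hZ₁ : IsClosed Z₁)
    (hstr : ∀ P : ComplexPoints X, P.pt ∈ C → P.pt ∉ Z₁ →
      ∃ (K : Submodule ℂ (Fin 3 → ℂ)) (e : OpenPartialHomeomorph (ComplexPoints X) ((Fin 2 → ℂ) × K)),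
        P ∈ e.source ∧ ∀ Q ∈ e.source, Q.pt ∈ C ↔ (e Q).1 = 0)
    {q : ℕ} (hq : q < 4) :
    IsZero (relativeSingularHomology R M (complexPointsCompl X Z₁)
      {Q : complexPointsCompl X Z₁ | Q.1.pt ∉ C} q) := by
  -- second countability of `X(ℂ)`
  haveI := hX.smoothOfRelativeDimension
  haveI : LocallyOfFiniteType X.hom := by
    haveI : Smooth X.hom := SmoothOfRelativeDimension.smooth 3 _
    infer_instance
  haveI := IsSmoothProjective.compactSpace_holds hX
  haveI : SecondCountableTopology (ComplexPoints X) :=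
    ComplexPoints.secondCountableTopology_of_compactSpace_holds X
  -- the open subspace `U = (X ∖ Z₁)(ℂ)` and its closed subset `S = C(ℂ) ∩ U`
  have hO : IsOpen {P : ComplexPoints X | P.pt ∉ Z₁} :=
    AlgPoints.isOpen_setOf_pt_mem (X := X) (L := ℂ) ⟨Z₁ᶜ, hZ₁.isOpen_compl⟩
  set S : Set (complexPointsCompl X Z₁) := {Q | Q.1.pt ∈ C} with hSdef
  have hS : IsClosed S := by
    have h1 : IsClosed {P : ComplexPoints X | P.pt ∈ C} :=
      ⟨AlgPoints.isOpen_setOf_pt_mem (X := X) (L := ℂ) ⟨Cᶜ, hC.isOpen_compl⟩⟩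
    exact h1.preimage continuous_subtype_val
  -- local flatness of `S` in `U`, real codimension `4`
  have hflat : ∀ x ∈ S, ∃ (F : Type) (_ : NormedAddCommGroup F) (_ : NormedSpace ℝ F)
      (_ : FiniteDimensional ℝ F) (K : Type) (_ : NormedAddCommGroup K) (_ : NormedSpace ℝ K)
      (e : OpenPartialHomeomorph (complexPointsCompl X Z₁) (F × K)),
      4 ≤ Module.finrank ℝ F ∧ x ∈ e.source ∧ ∀ z ∈ e.source, z ∈ S ↔ (e z).1 = 0 := by
    intro x hx
    obtain ⟨K, e, hxe, he⟩ := hstr x.1 hx x.2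
    let s : Opens (ComplexPoints X) := ⟨{P | P.pt ∉ Z₁}, hO⟩
    let e' : OpenPartialHomeomorph (complexPointsCompl X Z₁) ((Fin 2 → ℂ) × ↥K) :=
      e.subtypeRestr (s := s) ⟨x⟩
    refine ⟨Fin 2 → ℂ, inferInstance, inferInstance, inferInstance, ↥K, inferInstance,
      inferInstance, e', ?_, ?_, fun z hz ↦ ?_⟩
    · rw [Module.finrank_pi_fintype, Finset.sum_const, Finset.card_univ, Fintype.card_fin,
        Complex.finrank_real_complex, smul_eq_mul]
    · rw [OpenPartialHomeomorph.subtypeRestr_source]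
      exact hxe
    · rw [OpenPartialHomeomorph.subtypeRestr_source] at hz
      exact he z.1 hz
  haveI : SecondCountableTopology (complexPointsCompl X Z₁) :=
    TopologicalSpace.Subtype.secondCountableTopology _
  have heng := surjective_injective_map_compl_of_locallyFlat R M hS 4 hflat
  -- `Sᶜ = U ∖ S = {Q | pt Q ∉ C}`
  change IsZero (relativeSingularHomology R M (complexPointsCompl X Z₁) Sᶜ q)
  rcases q with _ | q
  · exact isZero_relativeSingularHomology_zero_of_surjective R M Sᶜ (heng.1 0 hq)
  · exact isZero_relativeSingularHomology_succ_of_surjective_of_injective R M Sᶜ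
      (heng.1 (q + 1) hq) (heng.2 q hq)

end HodgeConjecture
end Barriers

end Literature.Barriers.HodgeConjecture

end
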